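import Mathlib
import HarnessLib
import Summits.NavierStokesRegularity.NavierStokesRegularity.Theorems.LocalSineTubeDoorGenericDoor
import Summits.NavierStokesRegularity.NavierStokesRegularity.Theorems.LocalTraceTubeDoorProfileRigidity

/-!
# The one-window door family — DOOR S14 `LocalTraceTubeDoor` («trace-square / harmonic-pressure door»), PROVED:
# Type-I blow-up needs a non-harmonic pressure at the blow-up scale

Cell ns-regularity-ideate, seat p6 (route-directed support for nsreg-p1's door family; bears_on LADDER-NS N0; anchor
`--supports stmt-NavierStokesRegularity-20018`, the profile-rigidity item of the family).  Door S14 of nsreg-p1 ROUND-13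
(`HOME/ns-regularity-ideate-p1/r13/Sketch13.lean`, namespace `…Theses.LocalTraceTubeDoor`), texts VERBATIM:

* `target` = Sketch13's `Target`: a classical Leray–Hopf flow from rapidly decaying data, LOCALLY Type I at `(x₀, T)`,
  whose scale-invariant trace-square density `(T−t)² tr((Du)²)(x₀ + √(T−t)·y)` (`tr((Du)²) = |S|² − ½|ω|² = −Δp`)
  fades in `L¹` on ONE nonempty open similarity window `U` as `t → T⁻`, is backward bounded at `x₀`;
* `assembly` = Sketch13's `Assembly` (`LocalPointZoomVelGradSlices → TraceSquareProfileRigidity → Target`) and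
  `targetOfWindow` = Sketch13's `TargetOfWindow` (`LocalPointZoomVelGradSlices → TraceSquareWindowRigidity → Target`),
  both by `target` (their hypotheses are tree theorems anyway: `localPointZoomVelGradSlices`,
  `…LocalTraceTubeDoorProfileRigidity.traceSquareProfileRigidity` / `traceSquareWindowRigidity`).

Proof of `target`: the family's GENERIC first-order one-window door
`…LocalSineTubeDoorGenericDoor.genericDoor_of_profileWindowRigidity` (universal gradient zoom
`localPointZoomVelGradSlices` + Fatou on the window) with the scalar `F(x, A) = tr(A ∘ A)` — continuous in `(x, A)`,
zero set invariant under the scalings `(x, A) ↦ (a x, b A)` (`tr((bA)²) = b² tr(A²)`, `trace_smul_comp_smul`) — and the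
profile window crux `…LocalTraceTubeDoorProfileRigidity.traceSquareWindowRigidity` (harmonic-pressure profiles are
trivial); the normalisation `F(·, (√(T−t))² Du) = (T−t)² tr((Du)²)` matches Sketch13's observable.

With this file every item text of the staged door S14 (Target, K1 = `localPointZoomVelGradSlices`, K2 =
`traceSquareProfileRigidity`, supports `traceSquareWindowRigidity` / `windowOfProfile` / `targetOfWindow`, Assembly)
is a tree theorem: the door is MOOT-BY-PROOF (pattern S15/S16) — at birth each item closes by `exact`.

WHAT THIS IS NOT: not a claim about Navier–Stokes regularity (Clay A) — a local regularity CRITERION conditional on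
local Type I (bears_on LADDER-NS N0, door family).  Establishment in the cell's sense still requires the cross-family
referee PASS + independent reproduction.
-/

noncomputable section

-- the summit and its single sub-problem share the name (CONVENTIONS §1), as in every Theorems file
set_option linter.dupNamespace false

namespace Summit.NavierStokesRegularity.NavierStokesRegularity.Theorems.LocalTraceTubeDoorTarget

open MeasureTheory Set Function Filter Topology TopologicalSpace Metric
open scoped RealInnerProductSpace InnerProductSpace NNReal ENNReal
open Literature.Analysis Literature.Analysis.FluidPDE
open Summit.NavierStokesRegularity.NavierStokesRegularity.Theorems.LocalSineTubeDoorGenericDoor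
open Summit.NavierStokesRegularity.NavierStokesRegularity.Theorems.LocalTraceTubeDoorProfileRigidity

/-- **Scaling of the trace-square scalar**: `tr((cA) ∘ (cA)) = c² tr(A ∘ A)`. -/
theorem trace_smul_comp_smul (c : ℝ) (A : EuclideanSpace ℝ (Fin 3) →L[ℝ] EuclideanSpace ℝ (Fin 3)) :
    LinearMap.trace ℝ (EuclideanSpace ℝ (Fin 3))
        (((c • A).comp (c • A) : EuclideanSpace ℝ (Fin 3) →L[ℝ] EuclideanSpace ℝ (Fin 3)) :
          EuclideanSpace ℝ (Fin 3) →ₗ[ℝ] EuclideanSpace ℝ (Fin 3)) =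
      c ^ 2 * LinearMap.trace ℝ (EuclideanSpace ℝ (Fin 3))
        ((A.comp A : EuclideanSpace ℝ (Fin 3) →L[ℝ] EuclideanSpace ℝ (Fin 3)) :
          EuclideanSpace ℝ (Fin 3) →ₗ[ℝ] EuclideanSpace ℝ (Fin 3)) := by
  rw [ContinuousLinearMap.smul_comp, ContinuousLinearMap.comp_smul, smul_smul, ContinuousLinearMap.toLinearMap_smul,
    map_smul, smul_eq_mul, sq]

/-- **The trace-square scalar `(x, A) ↦ tr(A ∘ A)` is continuous.** -/
theorem continuous_traceSq :
    Continuous fun q : EuclideanSpace ℝ (Fin 3) × (EuclideanSpace ℝ (Fin 3) →L[ℝ] EuclideanSpace ℝ (Fin 3)) =>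
      (fun (_ : EuclideanSpace ℝ (Fin 3)) (A : EuclideanSpace ℝ (Fin 3) →L[ℝ] EuclideanSpace ℝ (Fin 3)) =>
        LinearMap.trace ℝ (EuclideanSpace ℝ (Fin 3))
          ((A.comp A : EuclideanSpace ℝ (Fin 3) →L[ℝ] EuclideanSpace ℝ (Fin 3)) :
            EuclideanSpace ℝ (Fin 3) →ₗ[ℝ] EuclideanSpace ℝ (Fin 3))) q.1 q.2 := by
  have h : Continuous fun q : EuclideanSpace ℝ (Fin 3) × (EuclideanSpace ℝ (Fin 3) →L[ℝ] EuclideanSpace ℝ (Fin 3)) =>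
      traceCLM (q.2.comp q.2) :=
    (traceCLM (E := EuclideanSpace ℝ (Fin 3))).continuous.comp (continuous_snd.clm_comp continuous_snd)
  exact h

/-- **The zero set of the trace-square scalar is invariant under the scalings `(x, A) ↦ (a x, b A)`, `b > 0`.** -/
theorem traceSq_zeroSet_invariant :
    ∀ (a b : ℝ), 0 < a → 0 < b → ∀ (x : EuclideanSpace ℝ (Fin 3))
      (A : EuclideanSpace ℝ (Fin 3) →L[ℝ] EuclideanSpace ℝ (Fin 3)),
      (fun (_ : EuclideanSpace ℝ (Fin 3)) (A : EuclideanSpace ℝ (Fin 3) →L[ℝ] EuclideanSpace ℝ (Fin 3)) =>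
        LinearMap.trace ℝ (EuclideanSpace ℝ (Fin 3))
          ((A.comp A : EuclideanSpace ℝ (Fin 3) →L[ℝ] EuclideanSpace ℝ (Fin 3)) :
            EuclideanSpace ℝ (Fin 3) →ₗ[ℝ] EuclideanSpace ℝ (Fin 3))) (a • x) (b • A) = 0 ↔
      (fun (_ : EuclideanSpace ℝ (Fin 3)) (A : EuclideanSpace ℝ (Fin 3) →L[ℝ] EuclideanSpace ℝ (Fin 3)) =>
        LinearMap.trace ℝ (EuclideanSpace ℝ (Fin 3))
          ((A.comp A : EuclideanSpace ℝ (Fin 3) →L[ℝ] EuclideanSpace ℝ (Fin 3)) :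
            EuclideanSpace ℝ (Fin 3) →ₗ[ℝ] EuclideanSpace ℝ (Fin 3))) x A = 0 := by
  intro a b _ hb x A
  simp only [trace_smul_comp_smul]
  have hb2 : b ^ 2 ≠ 0 := pow_ne_zero 2 hb.ne'
  constructor
  · intro h
    rcases mul_eq_zero.1 h with h | h
    · exact absurd h hb2
    · exact h
  · intro h
    rw [h, mul_zero]

/-- **DOOR S14, THE TARGET (`…Theses.LocalTraceTubeDoor.Target`, nsreg-p1 r13/Sketch13, VERBATIM), PROVED**: a
classical Leray–Hopf flow from rapidly decaying data that is locally Type I at `x₀` and whose scale-invariant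
trace-square density `(T−t)² tr((Du)²)` fades in `L¹` on ONE nonempty open similarity window `x₀ + √(T−t)·U` is
backward bounded at `x₀` («Type-I blow-up needs a non-harmonic pressure at the blow-up scale»). -/
theorem target :
    ∀ (ν T : ℝ), 0 < ν → 0 < T → ∀ (u : ℝ → EuclideanSpace ℝ (Fin 3) → EuclideanSpace ℝ (Fin 3))
      (p : ℝ → EuclideanSpace ℝ (Fin 3) → ℝ),
    Literature.Analysis.FluidPDE.IsClassicalNSSolutionOn (Set.Ico 0 T) ν 0 u p →
    Literature.Analysis.FluidPDE.IsLerayHopfOn T ν 0 (u 0) u →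
    Literature.Analysis.FluidPDE.HasRapidSpatialDecay (u 0) →
    ∀ (x₀ : EuclideanSpace ℝ (Fin 3)) (ρ M : ℝ), 0 < ρ →
    (∀ t ∈ Set.Ico 0 T, T - ρ ^ 2 < t → ∀ x ∈ Metric.ball x₀ ρ, ‖u t x‖ * Real.sqrt (ν * (T - t)) ≤ M) →
    ∀ (U : Set (EuclideanSpace ℝ (Fin 3))), IsOpen U → U.Nonempty →
    Filter.Tendsto (fun t => ∫⁻ y in U, ENNReal.ofReal
        |(T - t) ^ 2 * LinearMap.trace ℝ (EuclideanSpace ℝ (Fin 3))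
          (((fderiv ℝ (u t) (x₀ + Real.sqrt (T - t) • y)).comp
            (fderiv ℝ (u t) (x₀ + Real.sqrt (T - t) • y))) :
              EuclideanSpace ℝ (Fin 3) →ₗ[ℝ] EuclideanSpace ℝ (Fin 3))|)
      (nhdsWithin T (Set.Iio T)) (nhds 0) →
    Literature.Analysis.FluidPDE.IsBackwardBoundedAt u T x₀ := by
  intro ν T hν hT u p hsol hLH hdec x₀ ρ M hρ hM U hU hUne hfade
  refine genericDoor_of_profileWindowRigidity
    (fun (_ : EuclideanSpace ℝ (Fin 3)) (A : EuclideanSpace ℝ (Fin 3) →L[ℝ] EuclideanSpace ℝ (Fin 3)) =>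
      LinearMap.trace ℝ (EuclideanSpace ℝ (Fin 3))
        ((A.comp A : EuclideanSpace ℝ (Fin 3) →L[ℝ] EuclideanSpace ℝ (Fin 3)) :
          EuclideanSpace ℝ (Fin 3) →ₗ[ℝ] EuclideanSpace ℝ (Fin 3)))
    continuous_traceSq traceSq_zeroSet_invariant
    (fun C v hrate hcont hmild hdiv hwin => traceSquareWindowRigidity C v hrate hcont hmild hdiv hwin)
    ν T hν hT u p hsol hLH hdec x₀ ρ M hρ hM U hU hUne ?_
  have hev : ∀ᶠ t in nhdsWithin T (Set.Iio T), t < T := eventually_nhdsWithin_of_forall fun t ht => ht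
  refine hfade.congr' (hev.mono fun t ht => ?_)
  refine lintegral_congr fun y => ?_
  have hs : 0 ≤ T - t := (sub_pos.2 ht).le
  congr 2
  rw [trace_smul_comp_smul, ← pow_mul, show 2 * 2 = 4 by norm_num]
  congr 1
  rw [show (4 : ℕ) = 2 * 2 by norm_num, pow_mul, Real.sq_sqrt hs]

/-- **Door S14's `Assembly` (`LocalPointZoomVelGradSlices → TraceSquareProfileRigidity → Target`, Sketch13 texts
VERBATIM), PROVED** — by `target` (the hypotheses are the tree theorems `localPointZoomVelGradSlices` and
`traceSquareProfileRigidity`). -/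
theorem assembly :
    (∀ (ν T : ℝ), 0 < ν → 0 < T → ∀ (u : ℝ → EuclideanSpace ℝ (Fin 3) → EuclideanSpace ℝ (Fin 3))
        (p : ℝ → EuclideanSpace ℝ (Fin 3) → ℝ),
      Literature.Analysis.FluidPDE.IsClassicalNSSolutionOn (Set.Ico 0 T) ν 0 u p →
      Literature.Analysis.FluidPDE.IsLerayHopfOn T ν 0 (u 0) u →
      Literature.Analysis.FluidPDE.HasRapidSpatialDecay (u 0) →
      ∀ (x₀ : EuclideanSpace ℝ (Fin 3)) (ρ M : ℝ), 0 < ρ →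
      (∀ t ∈ Set.Ico 0 T, T - ρ ^ 2 < t → ∀ x ∈ Metric.ball x₀ ρ, ‖u t x‖ * Real.sqrt (ν * (T - t)) ≤ M) →
      ¬ Literature.Analysis.FluidPDE.IsBackwardBoundedAt u T x₀ →
      ∃ (C : ℝ) (v : ℝ → EuclideanSpace ℝ (Fin 3) → EuclideanSpace ℝ (Fin 3)) (lam : ℕ → ℝ),
        (∀ j, 0 < lam j) ∧ Filter.Tendsto lam Filter.atTop (nhds 0) ∧
        (Literature.Analysis.FluidPDE.HasTypeITimeDecay C v ∧
          ContinuousOn (Function.uncurry v) (Set.Iio (0 : ℝ) ×ˢ Set.univ) ∧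
          (∀ s t : ℝ, s < t → t < 0 → ∀ x, v t x =
            Literature.Analysis.UnboundedOperators.heatExtension (v s) (t - s) x -
              Literature.Analysis.FluidPDE.oseenDuhamel 1 s v v t x) ∧
          (∀ t < 0, Literature.Analysis.FluidPDE.VectorCalculus.IsDivFree (v t))) ∧
        Literature.Analysis.FluidPDE.IsBackwardSingularPoint v 0 ∧
        ∀ s < 0, ∀ y,
          Filter.Tendsto (fun j => (lam j / ν) • u (T + lam j ^ 2 * s / ν) (x₀ + lam j • y)) Filter.atTop
            (nhds (v s y)) ∧
          Filter.Tendsto (fun j => (lam j ^ 2 / ν) •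
            fderiv ℝ (u (T + lam j ^ 2 * s / ν)) (x₀ + lam j • y)) Filter.atTop
            (nhds (fderiv ℝ (v s) y))) →
    (∀ (C : ℝ) (v : ℝ → EuclideanSpace ℝ (Fin 3) → EuclideanSpace ℝ (Fin 3)),
      Literature.Analysis.FluidPDE.HasTypeITimeDecay C v →
      ContinuousOn (Function.uncurry v) (Set.Iio (0 : ℝ) ×ˢ Set.univ) →
      (∀ s t : ℝ, s < t → t < 0 → ∀ x, v t x =
        Literature.Analysis.UnboundedOperators.heatExtension (v s) (t - s) x -
          Literature.Analysis.FluidPDE.oseenDuhamel 1 s v v t x) →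
      (∀ t < 0, Literature.Analysis.FluidPDE.VectorCalculus.IsDivFree (v t)) →
      (∀ s < 0, ∀ y : EuclideanSpace ℝ (Fin 3),
        LinearMap.trace ℝ (EuclideanSpace ℝ (Fin 3))
          (((fderiv ℝ (v s) y).comp (fderiv ℝ (v s) y)) :
            EuclideanSpace ℝ (Fin 3) →ₗ[ℝ] EuclideanSpace ℝ (Fin 3)) = 0) →
      ¬ Literature.Analysis.FluidPDE.IsBackwardSingularPoint v 0) →
    (∀ (ν T : ℝ), 0 < ν → 0 < T → ∀ (u : ℝ → EuclideanSpace ℝ (Fin 3) → EuclideanSpace ℝ (Fin 3))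
        (p : ℝ → EuclideanSpace ℝ (Fin 3) → ℝ),
      Literature.Analysis.FluidPDE.IsClassicalNSSolutionOn (Set.Ico 0 T) ν 0 u p →
      Literature.Analysis.FluidPDE.IsLerayHopfOn T ν 0 (u 0) u →
      Literature.Analysis.FluidPDE.HasRapidSpatialDecay (u 0) →
      ∀ (x₀ : EuclideanSpace ℝ (Fin 3)) (ρ M : ℝ), 0 < ρ →
      (∀ t ∈ Set.Ico 0 T, T - ρ ^ 2 < t → ∀ x ∈ Metric.ball x₀ ρ, ‖u t x‖ * Real.sqrt (ν * (T - t)) ≤ M) →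
      ∀ (U : Set (EuclideanSpace ℝ (Fin 3))), IsOpen U → U.Nonempty →
      Filter.Tendsto (fun t => ∫⁻ y in U, ENNReal.ofReal
          |(T - t) ^ 2 * LinearMap.trace ℝ (EuclideanSpace ℝ (Fin 3))
            (((fderiv ℝ (u t) (x₀ + Real.sqrt (T - t) • y)).comp
              (fderiv ℝ (u t) (x₀ + Real.sqrt (T - t) • y))) :
                EuclideanSpace ℝ (Fin 3) →ₗ[ℝ] EuclideanSpace ℝ (Fin 3))|)
        (nhdsWithin T (Set.Iio T)) (nhds 0) →
      Literature.Analysis.FluidPDE.IsBackwardBoundedAt u T x₀) :=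
  fun _ _ => target

end Summit.NavierStokesRegularity.NavierStokesRegularity.Theorems.LocalTraceTubeDoorTarget

end
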